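import Summits.CriticalPhenomena.CardyFormulaZ2.Theorems.CardySelfRefinementLagHandOffDiscreteLocalityPatchCut
import Summits.CriticalPhenomena.CardyFormulaZ2.Theorems.CardySelfRefinementLagHandOffDiscreteSplitting
import HarnessLib

/-!
# Patching the labellings of nested domains, II (no forcing): helper for stub `stub_discreteLocality`
(R3a) of line `hitting-tournament` for crux `LagHandOff` (stmt-CriticalPhenomena-10268)

Continuation of `…DiscreteLocalityPatchCut.lean`: the patched labelling `P ⊔ Q` of the boundary of
`Ω_δ(D'')` has the NO-FORCING property (no disc of a `P`-site is covered by the discs of the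
`Q`-sites and vice versa) as soon as the two given labellings have it: at the seam (away from `a, b`)
a `P`-site and a `Q`-site are never two meshes apart (separation of the arcs); near `a` (and near a
far `b`) the discs are those of the labelling of `D` (the distances to the two frontiers agree off
`F`), near `b ∈ F` those of the labelling of `D''` (`locality_patch`, the full ten properties).

## Compatible labellings of nested domains at every small mesh

For Dobrushin domains `D'' ⊆ D` with the same marked points, compatible arcs and `a` off the removed
part `F = closure (D ∖ D'')`, and for every tolerance `η > 0`: for all small meshes `δ` there are a
labelling `SA ⊔ SB` of the square-lattice boundary of `Ω_δ(D)` and a labelling `P ⊔ Q` of that of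
`Ω_δ(D'')`, both with the ten properties of `eventually_labelling` at tolerance `η` and cut
midpoints within `η` of `{a, b}`, which AGREE (labels and discrete domains) at every site `θ`-far
from `F` for some `0 < θ ≤ η`, and share the cut edge `e_a`, `(θ + 4δ)`-far from `F`
(`locality_labels`).  Proof: `eventually_labelling` for `D` and for `D''` at a tolerance `ε` small
against the geometry (`exists_arcs_separated`, the distances of `a`, `b` to `F`), the lattice
locality `eventually_mem_inner_of_far` / `eventually_meshDomain_inner_subset`, and the one-mesh
patch `locality_patch` (above).
-/

noncomputable section

open MeasureTheory Filter Set Topology Metric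
open scoped unitInterval BoundedContinuousFunction
open Literature.Probability.Percolation Literature.Probability.LatticeModels
open Literature.Probability.RandomPlanarGeometry Literature.Probability.Percolation.QuadCrossing
open Summit.CriticalPhenomena.CardyFormulaZ2.Theorems.DiscretisationFamilyExists

namespace Summit.CriticalPhenomena.CardyFormulaZ2.Cruxes.LagHandOff.HittingTournament

set_option maxHeartbeats 3200000 in
/-- **Patching the labellings of nested domains (all ten properties).** See the module docstrings
of this file and of part I. -/
theorem locality_patch (D D'' : DobrushinDomain) (hsub : D''.carrier ⊆ D.carrier)
    (hA0 : ∀ z ∈ D.arc 0, z ∉ closure (D.carrier \ D''.carrier) → z ∈ D''.arc 0)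
    (hA1 : ∀ z ∈ D.arc 1, z ∉ closure (D.carrier \ D''.carrier) → z ∈ D''.arc 1)
    {δ ε θ μ : ℝ} (hδ : 0 < δ)
    (hμ : ∀ z : ℂ, θ / 2 ≤ dist z (D.pt 0) → θ / 2 ≤ dist z (D.pt 1) →
      infDist z (D''.arc 0) ≤ μ → infDist z (D''.arc 1) ≤ μ → False)
    (ha : ∀ z ∈ closure (D.carrier \ D''.carrier), 3 * θ ≤ dist (D.pt 0) z)
    (hb : D.pt 1 ∈ closure (D.carrier \ D''.carrier) ∨
      ∀ z ∈ closure (D.carrier \ D''.carrier), 3 * θ ≤ dist (D.pt 1) z)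
    (hab : 2 * θ ≤ dist (D.pt 0) (D.pt 1)) (hεμ : ε + 2 * δ ≤ μ) (hδθ : 16 * δ ≤ θ) (hεθ : 4 * ε ≤ θ)
    (hMM : ∀ v : Site 2, (∀ z ∈ closure (D.carrier \ D''.carrier), θ / 4 ≤ dist (meshPoint δ v) z) →
      (v ∈ meshDomain D.carrier δ ↔ v ∈ meshDomain D''.carrier δ))
    {SA SB SA' SB' P Q : Set (Site 2)} {ea eb ea' eb' : Sym2 (Site 2)}
    (hU : SA ∪ SB = (⟨D.carrier, δ, ∅, ∅⟩ : DiscreteDobrushin).zdBoundary) (hdj : Disjoint SA SB)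
    (hNFA : ∀ y ∈ SA, ¬ closedBall (meshPoint δ y) (infDist (meshPoint δ y) (frontier D.carrier)) ⊆
      ⋃ x ∈ SB, closedBall (meshPoint δ x) (infDist (meshPoint δ x) (frontier D.carrier)))
    (hNFB : ∀ x ∈ SB, ¬ closedBall (meshPoint δ x) (infDist (meshPoint δ x) (frontier D.carrier)) ⊆
      ⋃ y ∈ SA, closedBall (meshPoint δ y) (infDist (meshPoint δ y) (frontier D.carrier)))
    (hsA : ∀ y ∈ SA, infDist (meshPoint δ y) (D.arc 0) ≤ ε)
    (hsB : ∀ x ∈ SB, infDist (meshPoint δ x) (D.arc 1) ≤ ε)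
    (hAB : {e | e ∈ (discreteDomainGraph D.carrier δ).edgeSet ∧ (∃ x ∈ e, x ∈ SA) ∧ ∃ y ∈ e, y ∈ SB} =
      {ea, eb})
    (hea : dist (medialPoint δ ea) (D.pt 0) ≤ ε) (heb : dist (medialPoint δ eb) (D.pt 1) ≤ ε)
    (hinner : ∀ e ∈ (discreteDomainGraph D.carrier δ).edgeSet, (∃ x ∈ e, x ∈ SA) → (∃ y ∈ e, y ∈ SB) →
      ∃! f, (⟨D.carrier, δ, ∅, ∅⟩ : DiscreteDobrushin).IsInnerFace f ∧ ∀ x ∈ e, IsCorner x f)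
    (hU' : SA' ∪ SB' = (⟨D''.carrier, δ, ∅, ∅⟩ : DiscreteDobrushin).zdBoundary) (hdj' : Disjoint SA' SB')
    (hNFA' : ∀ y ∈ SA', ¬ closedBall (meshPoint δ y) (infDist (meshPoint δ y) (frontier D''.carrier)) ⊆
      ⋃ x ∈ SB', closedBall (meshPoint δ x) (infDist (meshPoint δ x) (frontier D''.carrier)))
    (hNFB' : ∀ x ∈ SB', ¬ closedBall (meshPoint δ x) (infDist (meshPoint δ x) (frontier D''.carrier)) ⊆
      ⋃ y ∈ SA', closedBall (meshPoint δ y) (infDist (meshPoint δ y) (frontier D''.carrier)))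
    (hsA' : ∀ y ∈ SA', infDist (meshPoint δ y) (D''.arc 0) ≤ ε)
    (hsB' : ∀ x ∈ SB', infDist (meshPoint δ x) (D''.arc 1) ≤ ε)
    (hAB' : {e | e ∈ (discreteDomainGraph D''.carrier δ).edgeSet ∧ (∃ x ∈ e, x ∈ SA') ∧ ∃ y ∈ e, y ∈ SB'} =
      {ea', eb'})
    (hea' : dist (medialPoint δ ea') (D.pt 0) ≤ ε) (heb' : dist (medialPoint δ eb') (D.pt 1) ≤ ε)
    (hinner' : ∀ e ∈ (discreteDomainGraph D''.carrier δ).edgeSet, (∃ x ∈ e, x ∈ SA') → (∃ y ∈ e, y ∈ SB') →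
      ∃! f, (⟨D''.carrier, δ, ∅, ∅⟩ : DiscreteDobrushin).IsInnerFace f ∧ ∀ x ∈ e, IsCorner x f)
    (hP : P = {y | y ∈ (⟨D''.carrier, δ, ∅, ∅⟩ : DiscreteDobrushin).zdBoundary ∧
      ((y ∈ SA ∧ ∀ z ∈ closure (D.carrier \ D''.carrier), θ ≤ dist (meshPoint δ y) z) ∨
        (y ∈ SA' ∧ ¬ ∀ z ∈ closure (D.carrier \ D''.carrier), θ ≤ dist (meshPoint δ y) z))})
    (hQ : Q = (⟨D''.carrier, δ, ∅, ∅⟩ : DiscreteDobrushin).zdBoundary \ P) :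
    (P ∪ Q = (⟨D''.carrier, δ, ∅, ∅⟩ : DiscreteDobrushin).zdBoundary ∧
      Disjoint P Q ∧ P.Nonempty ∧ Q.Nonempty ∧
      (∀ y ∈ P, ¬ closedBall (meshPoint δ y) (infDist (meshPoint δ y) (frontier D''.carrier)) ⊆
        ⋃ x ∈ Q, closedBall (meshPoint δ x) (infDist (meshPoint δ x) (frontier D''.carrier))) ∧
      (∀ x ∈ Q, ¬ closedBall (meshPoint δ x) (infDist (meshPoint δ x) (frontier D''.carrier)) ⊆
        ⋃ y ∈ P, closedBall (meshPoint δ y) (infDist (meshPoint δ y) (frontier D''.carrier))) ∧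
      (∀ y ∈ P, infDist (meshPoint δ y) (D''.arc 0) ≤ ε) ∧
      (∀ x ∈ Q, infDist (meshPoint δ x) (D''.arc 1) ≤ ε) ∧
      {e | e ∈ (discreteDomainGraph D''.carrier δ).edgeSet ∧ (∃ x ∈ e, x ∈ P) ∧ ∃ y ∈ e, y ∈ Q}.ncard = 2 ∧
      ∀ e ∈ (discreteDomainGraph D''.carrier δ).edgeSet, (∃ x ∈ e, x ∈ P) → (∃ y ∈ e, y ∈ Q) →
        ∃! f, (⟨D''.carrier, δ, ∅, ∅⟩ : DiscreteDobrushin).IsInnerFace f ∧ ∀ x ∈ e, IsCorner x f) ∧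
    (∀ v : Site 2, (∀ z ∈ closure (D.carrier \ D''.carrier), θ ≤ dist (meshPoint δ v) z) →
      (v ∈ P ↔ v ∈ SA) ∧ (v ∈ Q ↔ v ∈ SB)) ∧
    (∀ x ∈ ea, ∀ z ∈ closure (D.carrier \ D''.carrier), 2 * θ ≤ dist (meshPoint δ x) z) ∧
    ∃ e2 : Sym2 (Site 2),
      {e | e ∈ (discreteDomainGraph D''.carrier δ).edgeSet ∧ (∃ x ∈ e, x ∈ P) ∧ ∃ y ∈ e, y ∈ Q} = {ea, e2} ∧
      ea ≠ e2 ∧ dist (medialPoint δ e2) (D.pt 1) ≤ ε := by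
  -- notation
  set F : Set ℂ := closure (D.carrier \ D''.carrier) with hF
  set bd'' := (⟨D''.carrier, δ, ∅, ∅⟩ : DiscreteDobrushin).zdBoundary with hbd''
  set a := D.pt 0 with haD
  set b := D.pt 1 with hbD
  have hδ0 : 0 ≤ δ := hδ.le
  have hθ : 0 < θ := by linarith
  -- part I: sides, cut edges, agreement, radii
  obtain ⟨⟨p1, p2, p3, p4, hsP, hsQ, p9, p10⟩, hagree, hnagree, hea_far, hrad, e2, hcut, hne2, he2⟩ :=
    locality_patch_cut D D'' hsub hA0 hA1 hδ hμ ha hb hab hεμ hδθ hεθ hMM hU hdj hsA hsB hAB hea heb hinner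
      hU' hdj' hsA' hsB' hAB' hea' heb' hinner' hP hQ
  have hPbd : P ⊆ bd'' := fun y hy => by rw [hP] at hy; exact hy.1
  have hQbd : Q ⊆ bd'' := fun x hx => by rw [hQ] at hx; exact hx.1
  have hP_far : ∀ y, (∀ z ∈ F, θ ≤ dist (meshPoint δ y) z) → (y ∈ P ↔ y ∈ SA) := fun y h => (hagree y h).1
  have hQ_far : ∀ x, (∀ z ∈ F, θ ≤ dist (meshPoint δ x) z) → (x ∈ Q ↔ x ∈ SB) := fun x h => (hagree x h).2
  have hP_near : ∀ y, (¬ ∀ z ∈ F, θ ≤ dist (meshPoint δ y) z) → (y ∈ P ↔ y ∈ SA') := fun y h => (hnagree y h).1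
  have hQ_near : ∀ x, (¬ ∀ z ∈ F, θ ≤ dist (meshPoint δ x) z) → (x ∈ Q ↔ x ∈ SB') := fun x h => (hnagree x h).2
  -- farness bookkeeping: monotone in the threshold, stable under small moves
  have far_mono : ∀ {v : Site 2} {s t : ℝ}, (∀ z ∈ F, t ≤ dist (meshPoint δ v) z) → s ≤ t →
      ∀ z ∈ F, s ≤ dist (meshPoint δ v) z := fun h hst z hz => hst.trans (h z hz)
  have far_move : ∀ {v w : Site 2} {t s : ℝ}, (∀ z ∈ F, t ≤ dist (meshPoint δ v) z) →
      dist (meshPoint δ w) (meshPoint δ v) ≤ s → ∀ z ∈ F, t - s ≤ dist (meshPoint δ w) z :=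
    fun h hd => far_of_dist_le h hd
  -- separation at the seam: a `P`-site and a `Q`-site two meshes apart are near `a` or near `b`
  have hsep : ∀ y ∈ P, ∀ x ∈ Q, dist (meshPoint δ y) (meshPoint δ x) ≤ 2 * δ →
      θ / 2 ≤ dist (meshPoint δ y) a → θ / 2 ≤ dist (meshPoint δ y) b → False := by
    intro y hy x hx hd hya hyb
    refine hμ (meshPoint δ y) hya hyb ((hsP y hy).trans (by linarith)) ?_
    have := infDist_le_infDist_add_dist (s := D''.arc 1) (x := meshPoint δ y) (y := meshPoint δ x)
    linarith [hsQ x hx]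
  have hsep' : ∀ x ∈ Q, ∀ y ∈ P, dist (meshPoint δ x) (meshPoint δ y) ≤ 2 * δ →
      θ / 2 ≤ dist (meshPoint δ x) a → θ / 2 ≤ dist (meshPoint δ x) b → False := by
    intro x hx y hy hd hxa hxb
    refine hμ (meshPoint δ x) hxa hxb ?_ ((hsQ x hx).trans (by linarith))
    have := infDist_le_infDist_add_dist (s := D''.arc 0) (x := meshPoint δ x) (y := meshPoint δ y)
    linarith [hsP y hy]
  -- positions: near `a` (or near a far `b`) is deep far; near `b ∈ F` is deep near
  have hnear_a : ∀ {p : ℂ}, dist p a < θ / 2 → ∀ z ∈ F, 2 * θ ≤ dist p z := by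
    intro p hp z hz
    linarith [ha z hz, dist_triangle a p z, dist_comm a p]
  have hnear_b_far : ∀ {p : ℂ}, dist p b < θ / 2 → (∀ z ∈ F, 3 * θ ≤ dist b z) → ∀ z ∈ F, 2 * θ ≤ dist p z := by
    intro p hp hbf z hz
    linarith [hbf z hz, dist_triangle b p z, dist_comm b p]
  have hnear_b_in : ∀ {p q : ℂ}, dist p b < θ / 2 → b ∈ F → dist q p ≤ 4 * δ → ¬ ∀ z ∈ F, θ ≤ dist q z := by
    intro p q hp hbF hqp h
    have := h b hbF
    linarith [dist_triangle q p b]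
  refine ⟨⟨p1, p2, p3, p4, ?_, ?_, hsP, hsQ, p9, p10⟩, hagree, hea_far, e2, hcut, hne2, he2⟩
  · -- no forcing of `P` by `Q`
    intro y hy hcov
    have hybd : y ∈ bd'' := hPbd hy
    by_cases hmid : θ / 2 ≤ dist (meshPoint δ y) a ∧ θ / 2 ≤ dist (meshPoint δ y) b
    · -- at the seam: the centre of the disc of `y` lies in the disc of a `Q`-site two meshes away
      have hc : meshPoint δ y ∈ closedBall (meshPoint δ y) (infDist (meshPoint δ y) (frontier D''.carrier)) :=
        mem_closedBall_self infDist_nonneg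
      obtain ⟨x, hxQ, hyx⟩ : ∃ x ∈ Q, meshPoint δ y ∈ closedBall (meshPoint δ x)
          (infDist (meshPoint δ x) (frontier D''.carrier)) := by
        simpa only [mem_iUnion, exists_prop] using hcov hc
      have hd : dist (meshPoint δ y) (meshPoint δ x) ≤ 2 * δ := by
        rw [mem_closedBall] at hyx
        exact hyx.trans (infDist_frontier_le_two_mul D''.toJordanDomain hδ (hQbd hxQ))
      exact hsep y hy x hxQ hd hmid.1 hmid.2
    · rw [not_and_or, not_le, not_le] at hmid
      -- deep far (near `a`, or near a far `b`) or deep near (near `b ∈ F`)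
      have hdeep : (∀ z ∈ F, 2 * θ ≤ dist (meshPoint δ y) z) ∨ (dist (meshPoint δ y) b < θ / 2 ∧ b ∈ F) := by
        rcases hmid with h | h
        · exact Or.inl (hnear_a h)
        · rcases hb with hbF | hbfar
          · exact Or.inr ⟨h, hbF⟩
          · exact Or.inl (hnear_b_far h hbfar)
      rcases hdeep with hyfar | ⟨hyb, hbF⟩
      · -- deep far: `y ∈ SA`, and the disc of `y` for `D` is its disc for `D''`
        have hyA : y ∈ SA := (hP_far y (far_mono hyfar (by linarith))).1 hy
        have hry := hrad y hybd (far_mono hyfar (by linarith))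
        obtain ⟨q, hqy, hq⟩ := not_subset.1 (hNFA y hyA)
        rw [← hry] at hqy
        obtain ⟨x, hxQ, hqx⟩ : ∃ x ∈ Q, q ∈ closedBall (meshPoint δ x)
            (infDist (meshPoint δ x) (frontier D''.carrier)) := by
          simpa only [mem_iUnion, exists_prop] using hcov hqy
        have hxbd : x ∈ bd'' := hQbd hxQ
        have hdx := dist_le_four_mul_of_mem_closedBall D''.toJordanDomain hδ hxbd hybd hqy hqx
        have hxfar : ∀ z ∈ F, 2 * θ - 4 * δ ≤ dist (meshPoint δ x) z :=
          far_move hyfar (by rw [dist_comm]; exact hdx)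
        have hxB : x ∈ SB := (hQ_far x (far_mono hxfar (by linarith))).1 hxQ
        have hrx := hrad x hxbd (far_mono hxfar (by linarith))
        rw [hrx] at hqx
        exact hq (mem_iUnion₂.2 ⟨x, hxB, hqx⟩)
      · -- deep near: `y ∈ SA'`
        have hynear : ¬ ∀ z ∈ F, θ ≤ dist (meshPoint δ y) z := hnear_b_in hyb hbF (by rw [dist_self]; linarith)
        have hyA' : y ∈ SA' := (hP_near y hynear).1 hy
        obtain ⟨q, hqy, hq⟩ := not_subset.1 (hNFA' y hyA')
        obtain ⟨x, hxQ, hqx⟩ : ∃ x ∈ Q, q ∈ closedBall (meshPoint δ x)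
            (infDist (meshPoint δ x) (frontier D''.carrier)) := by
          simpa only [mem_iUnion, exists_prop] using hcov hqy
        have hdx := dist_le_four_mul_of_mem_closedBall D''.toJordanDomain hδ (hQbd hxQ) hybd hqy hqx
        have hxnear : ¬ ∀ z ∈ F, θ ≤ dist (meshPoint δ x) z := hnear_b_in hyb hbF (by rw [dist_comm]; exact hdx)
        have hxB' : x ∈ SB' := (hQ_near x hxnear).1 hxQ
        exact hq (mem_iUnion₂.2 ⟨x, hxB', hqx⟩)
  · -- no forcing of `Q` by `P`
    intro x hx hcov
    have hxbd : x ∈ bd'' := hQbd hx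
    by_cases hmid : θ / 2 ≤ dist (meshPoint δ x) a ∧ θ / 2 ≤ dist (meshPoint δ x) b
    · have hc : meshPoint δ x ∈ closedBall (meshPoint δ x) (infDist (meshPoint δ x) (frontier D''.carrier)) :=
        mem_closedBall_self infDist_nonneg
      obtain ⟨y, hyP, hxy⟩ : ∃ y ∈ P, meshPoint δ x ∈ closedBall (meshPoint δ y)
          (infDist (meshPoint δ y) (frontier D''.carrier)) := by
        simpa only [mem_iUnion, exists_prop] using hcov hc
      have hd : dist (meshPoint δ x) (meshPoint δ y) ≤ 2 * δ := by
        rw [mem_closedBall] at hxy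
        exact hxy.trans (infDist_frontier_le_two_mul D''.toJordanDomain hδ (hPbd hyP))
      exact hsep' x hx y hyP hd hmid.1 hmid.2
    · rw [not_and_or, not_le, not_le] at hmid
      have hdeep : (∀ z ∈ F, 2 * θ ≤ dist (meshPoint δ x) z) ∨ (dist (meshPoint δ x) b < θ / 2 ∧ b ∈ F) := by
        rcases hmid with h | h
        · exact Or.inl (hnear_a h)
        · rcases hb with hbF | hbfar
          · exact Or.inr ⟨h, hbF⟩
          · exact Or.inl (hnear_b_far h hbfar)
      rcases hdeep with hxfar | ⟨hxb, hbF⟩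
      · have hxB : x ∈ SB := (hQ_far x (far_mono hxfar (by linarith))).1 hx
        have hrx := hrad x hxbd (far_mono hxfar (by linarith))
        obtain ⟨q, hqx, hq⟩ := not_subset.1 (hNFB x hxB)
        rw [← hrx] at hqx
        obtain ⟨y, hyP, hqy⟩ : ∃ y ∈ P, q ∈ closedBall (meshPoint δ y)
            (infDist (meshPoint δ y) (frontier D''.carrier)) := by
          simpa only [mem_iUnion, exists_prop] using hcov hqx
        have hybd : y ∈ bd'' := hPbd hyP
        have hdy := dist_le_four_mul_of_mem_closedBall D''.toJordanDomain hδ hybd hxbd hqx hqy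
        have hyfar : ∀ z ∈ F, 2 * θ - 4 * δ ≤ dist (meshPoint δ y) z :=
          far_move hxfar (by rw [dist_comm]; exact hdy)
        have hyA : y ∈ SA := (hP_far y (far_mono hyfar (by linarith))).1 hyP
        have hry := hrad y hybd (far_mono hyfar (by linarith))
        rw [hry] at hqy
        exact hq (mem_iUnion₂.2 ⟨y, hyA, hqy⟩)
      · have hxnear : ¬ ∀ z ∈ F, θ ≤ dist (meshPoint δ x) z := hnear_b_in hxb hbF (by rw [dist_self]; linarith)
        have hxB' : x ∈ SB' := (hQ_near x hxnear).1 hx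
        obtain ⟨q, hqx, hq⟩ := not_subset.1 (hNFB' x hxB')
        obtain ⟨y, hyP, hqy⟩ : ∃ y ∈ P, q ∈ closedBall (meshPoint δ y)
            (infDist (meshPoint δ y) (frontier D''.carrier)) := by
          simpa only [mem_iUnion, exists_prop] using hcov hqx
        have hdy := dist_le_four_mul_of_mem_closedBall D''.toJordanDomain hδ (hPbd hyP) hxbd hqx hqy
        have hynear : ¬ ∀ z ∈ F, θ ≤ dist (meshPoint δ y) z := hnear_b_in hxb hbF (by rw [dist_comm]; exact hdy)
        have hyA' : y ∈ SA' := (hP_near y hynear).1 hyP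
        exact hq (mem_iUnion₂.2 ⟨y, hyA', hqy⟩)

/-! ### Registered sub-goal (one-line signature, verbatim) -/

/-- **Registered sub-goal `stub_discreteLocality_patch` of `stub_discreteLocality`**: the patch of the two labellings with all ten properties (`locality_patch`), fully
quantified. -/
theorem stub_discreteLocality_patch : ∀ (D D'' : DobrushinDomain), (D''.carrier ⊆ D.carrier) → ∀ (F : Set ℂ), F = closure (D.carrier \ D''.carrier) → (∀ z ∈ D.arc 0, z ∉ F → z ∈ D''.arc 0) → (∀ z ∈ D.arc 1, z ∉ F → z ∈ D''.arc 1) → ∀ (δ ε θ μ : ℝ), ∀ (W : Set (Site 2)), W = (⟨D''.carrier, δ, ∅, ∅⟩ : DiscreteDobrushin).zdBoundary → (0 < δ) → (∀ z : ℂ, θ / 2 ≤ dist z (D.pt 0) → θ / 2 ≤ dist z (D.pt 1) → infDist z (D''.arc 0) ≤ μ → infDist z (D''.arc 1) ≤ μ → False) → (∀ z ∈ F, 3 * θ ≤ dist (D.pt 0) z) → (D.pt 1 ∈ F ∨ ∀ z ∈ F, 3 * θ ≤ dist (D.pt 1) z) → (2 * θ ≤ dist (D.pt 0) (D.pt 1))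 → (ε + 2 * δ ≤ μ) → (16 * δ ≤ θ) → (4 * ε ≤ θ) → (∀ v : Site 2, (∀ z ∈ F, θ / 4 ≤ dist (meshPoint δ v) z) → (v ∈ meshDomain D.carrier δ ↔ v ∈ meshDomain D''.carrier δ)) → ∀ (SA SB SA' SB' P Q : Set (Site 2)), ∀ (ea eb ea' eb' : Sym2 (Site 2)), (SA ∪ SB = (⟨D.carrier, δ, ∅, ∅⟩ : DiscreteDobrushin).zdBoundary) → (Disjoint SA SB) → (∀ y ∈ SA, ¬ closedBall (meshPoint δ y) (infDist (meshPoint δ y) (frontier D.carrier)) ⊆ ⋃ x ∈ SB, closedBall (meshPoint δ x) (infDist (meshPoint δ x) (frontier D.carrier))) → (∀ x ∈ SB, ¬ closedBall (meshPoint δ x) (infDist (meshPoint δ x) (frontier D.carrier)) ⊆ ⋃ y ∈ SA, closedBall (meshPoint δ y) (infDist (meshPoint δ y) (frontier D.carrier))) → (∀ y ∈ SA, infDist (meshPoint δ y) (D.arc 0) ≤ ε) → (∀ x ∈ SB, infDist (meshPoint δ x) (D.arc 1) ≤ ε) → ({e | e ∈ (discreteDomainGraph D.carrier δ).edgeSet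 ∧ (∃ x ∈ e, x ∈ SA) ∧ ∃ y ∈ e, y ∈ SB} = {ea, eb}) → (dist (medialPoint δ ea) (D.pt 0) ≤ ε) → (dist (medialPoint δ eb) (D.pt 1) ≤ ε) → (∀ e ∈ (discreteDomainGraph D.carrier δ).edgeSet, (∃ x ∈ e, x ∈ SA) → (∃ y ∈ e, y ∈ SB) → ∃! f, (⟨D.carrier, δ, ∅, ∅⟩ : DiscreteDobrushin).IsInnerFace f ∧ ∀ x ∈ e, IsCorner x f) → (SA' ∪ SB' = W) → (Disjoint SA' SB') → (∀ y ∈ SA', ¬ closedBall (meshPoint δ y) (infDist (meshPoint δ y) (frontier D''.carrier)) ⊆ ⋃ x ∈ SB', closedBall (meshPoint δ x) (infDist (meshPoint δ x) (frontier D''.carrier))) → (∀ x ∈ SB', ¬ closedBall (meshPoint δ x) (infDist (meshPoint δ x) (frontier D''.carrier)) ⊆ ⋃ y ∈ SA', closedBall (meshPoint δ y) (infDist (meshPoint δ y) (frontier D''.carrier))) → (∀ y ∈ SA', infDist (meshPoint δ y) (D''.arc 0) ≤ ε) → (∀ x ∈ SB', infDist (meshPoint δ x) (D''.arc 1) ≤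 ε) → ({e | e ∈ (discreteDomainGraph D''.carrier δ).edgeSet ∧ (∃ x ∈ e, x ∈ SA') ∧ ∃ y ∈ e, y ∈ SB'} = {ea', eb'}) → (dist (medialPoint δ ea') (D.pt 0) ≤ ε) → (dist (medialPoint δ eb') (D.pt 1) ≤ ε) → (∀ e ∈ (discreteDomainGraph D''.carrier δ).edgeSet, (∃ x ∈ e, x ∈ SA') → (∃ y ∈ e, y ∈ SB') → ∃! f, (⟨D''.carrier, δ, ∅, ∅⟩ : DiscreteDobrushin).IsInnerFace f ∧ ∀ x ∈ e, IsCorner x f) → (P = {y | y ∈ W ∧ ((y ∈ SA ∧ ∀ z ∈ F, θ ≤ dist (meshPoint δ y) z) ∨ (y ∈ SA' ∧ ¬ ∀ z ∈ F, θ ≤ dist (meshPoint δ y) z))}) → (Q = W \ P) → (P ∪ Q = W ∧ Disjoint P Q ∧ P.Nonempty ∧ Q.Nonempty ∧ (∀ y ∈ P, ¬ closedBall (meshPoint δ y) (infDist (meshPoint δ y) (frontier D''.carrier)) ⊆ ⋃ x ∈ Q, closedBall (meshPoint δ x) (infDist (meshPoint δ x) (frontier D''.carrier))) ∧ (∀ x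 ∈ Q, ¬ closedBall (meshPoint δ x) (infDist (meshPoint δ x) (frontier D''.carrier)) ⊆ ⋃ y ∈ P, closedBall (meshPoint δ y) (infDist (meshPoint δ y) (frontier D''.carrier))) ∧ (∀ y ∈ P, infDist (meshPoint δ y) (D''.arc 0) ≤ ε) ∧ (∀ x ∈ Q, infDist (meshPoint δ x) (D''.arc 1) ≤ ε) ∧ {e | e ∈ (discreteDomainGraph D''.carrier δ).edgeSet ∧ (∃ x ∈ e, x ∈ P) ∧ ∃ y ∈ e, y ∈ Q}.ncard = 2 ∧ ∀ e ∈ (discreteDomainGraph D''.carrier δ).edgeSet, (∃ x ∈ e, x ∈ P) → (∃ y ∈ e, y ∈ Q) → ∃! f, (⟨D''.carrier, δ, ∅, ∅⟩ : DiscreteDobrushin).IsInnerFace f ∧ ∀ x ∈ e, IsCorner x f) ∧ (∀ v : Site 2, (∀ z ∈ F, θ ≤ dist (meshPoint δ v) z) → (v ∈ P ↔ v ∈ SA) ∧ (v ∈ Q ↔ v ∈ SB)) ∧ (∀ x ∈ ea, ∀ z ∈ F, 2 * θ ≤ dist (meshPoint δ x) z) ∧ ∃ e2 : Sym2 (Site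 2), {e | e ∈ (discreteDomainGraph D''.carrier δ).edgeSet ∧ (∃ x ∈ e, x ∈ P) ∧ ∃ y ∈ e, y ∈ Q} = {ea, e2} ∧ ea ≠ e2 ∧ dist (medialPoint δ e2) (D.pt 1) ≤ ε := by
  intro D D'' hsub F hF hA0 hA1 _ _ _ _ W hW hδ hμ ha hb hab hεμ hδθ hεθ hMM _ _ _ _ _ _ _ _ _ _ hU hdj hNFA hNFB hsA hsB hAB hea heb hinner hU' hdj' hNFA' hNFB' hsA' hsB' hAB' hea' heb' hinner' hP hQ
  subst hF hW
  exact locality_patch D D'' hsub hA0 hA1 hδ hμ ha hb hab hεμ hδθ hεθ hMM hU hdj hNFA hNFB hsA hsB hAB hea heb hinner hU' hdj' hNFA' hNFB' hsA' hsB' hAB' hea' heb' hinner' hP hQ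


/-- A point off a closed set is uniformly far from it: `∃ t > 0, ∀ z ∈ F, 3t ≤ dist p z`. -/
theorem exists_pos_forall_le_dist_of_not_mem {F : Set ℂ} (hF : IsClosed F) {p : ℂ} (hp : p ∉ F) :
    ∃ t : ℝ, 0 < t ∧ ∀ z ∈ F, 3 * t ≤ dist p z := by
  rcases F.eq_empty_or_nonempty with h | hne
  · exact ⟨1, one_pos, fun z hz => by rw [h] at hz; exact hz.elim⟩
  · have hd : 0 < infDist p F := (hF.notMem_iff_infDist_pos hne).1 hp
    exact ⟨infDist p F / 3, by positivity, fun z hz => by linarith [infDist_le_dist_of_mem (x := p) hz]⟩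

set_option maxHeartbeats 3200000 in
/-- **Compatible labellings at every small mesh.** See the module docstring. -/
theorem locality_labels (D D'' : DobrushinDomain) (hsub : D''.carrier ⊆ D.carrier)
    (h0 : D''.pt 0 = D.pt 0) (h1 : D''.pt 1 = D.pt 1)
    (hA0 : ∀ z ∈ D.arc 0, z ∉ closure (D.carrier \ D''.carrier) → z ∈ D''.arc 0)
    (hA1 : ∀ z ∈ D.arc 1, z ∉ closure (D.carrier \ D''.carrier) → z ∈ D''.arc 1)
    (ha : D.pt 0 ∉ closure (D.carrier \ D''.carrier)) {η : ℝ} (hη : 0 < η) :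
    ∀ᶠ δ in 𝓝[>] (0 : ℝ), ∃ SA SB P Q : Set (Site 2),
      (SA ∪ SB = (⟨D.carrier, δ, ∅, ∅⟩ : DiscreteDobrushin).zdBoundary ∧
        Disjoint SA SB ∧ SA.Nonempty ∧ SB.Nonempty ∧
        (∀ y ∈ SA, ¬ closedBall (meshPoint δ y) (infDist (meshPoint δ y) (frontier D.carrier)) ⊆
          ⋃ x ∈ SB, closedBall (meshPoint δ x) (infDist (meshPoint δ x) (frontier D.carrier))) ∧
        (∀ x ∈ SB, ¬ closedBall (meshPoint δ x) (infDist (meshPoint δ x) (frontier D.carrier)) ⊆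
          ⋃ y ∈ SA, closedBall (meshPoint δ y) (infDist (meshPoint δ y) (frontier D.carrier))) ∧
        (∀ y ∈ SA, infDist (meshPoint δ y) (D.arc 0) ≤ η) ∧
        (∀ x ∈ SB, infDist (meshPoint δ x) (D.arc 1) ≤ η) ∧
        {e | e ∈ (discreteDomainGraph D.carrier δ).edgeSet ∧ (∃ x ∈ e, x ∈ SA) ∧ ∃ y ∈ e, y ∈ SB}.ncard = 2 ∧
        ∀ e ∈ (discreteDomainGraph D.carrier δ).edgeSet, (∃ x ∈ e, x ∈ SA) → (∃ y ∈ e, y ∈ SB) →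
          ∃! f, (⟨D.carrier, δ, ∅, ∅⟩ : DiscreteDobrushin).IsInnerFace f ∧ ∀ x ∈ e, IsCorner x f) ∧
      hausdorffEDist (medialPoint δ ''
        {e | e ∈ (discreteDomainGraph D.carrier δ).edgeSet ∧ (∃ x ∈ e, x ∈ SA) ∧ ∃ y ∈ e, y ∈ SB})
        {D.pt 0, D.pt 1} ≤ ENNReal.ofReal η ∧
      (P ∪ Q = (⟨D''.carrier, δ, ∅, ∅⟩ : DiscreteDobrushin).zdBoundary ∧
        Disjoint P Q ∧ P.Nonempty ∧ Q.Nonempty ∧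
        (∀ y ∈ P, ¬ closedBall (meshPoint δ y) (infDist (meshPoint δ y) (frontier D''.carrier)) ⊆
          ⋃ x ∈ Q, closedBall (meshPoint δ x) (infDist (meshPoint δ x) (frontier D''.carrier))) ∧
        (∀ x ∈ Q, ¬ closedBall (meshPoint δ x) (infDist (meshPoint δ x) (frontier D''.carrier)) ⊆
          ⋃ y ∈ P, closedBall (meshPoint δ y) (infDist (meshPoint δ y) (frontier D''.carrier))) ∧
        (∀ y ∈ P, infDist (meshPoint δ y) (D''.arc 0) ≤ η) ∧
        (∀ x ∈ Q, infDist (meshPoint δ x) (D''.arc 1) ≤ η) ∧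
        {e | e ∈ (discreteDomainGraph D''.carrier δ).edgeSet ∧ (∃ x ∈ e, x ∈ P) ∧ ∃ y ∈ e, y ∈ Q}.ncard = 2 ∧
        ∀ e ∈ (discreteDomainGraph D''.carrier δ).edgeSet, (∃ x ∈ e, x ∈ P) → (∃ y ∈ e, y ∈ Q) →
          ∃! f, (⟨D''.carrier, δ, ∅, ∅⟩ : DiscreteDobrushin).IsInnerFace f ∧ ∀ x ∈ e, IsCorner x f) ∧
      hausdorffEDist (medialPoint δ ''
        {e | e ∈ (discreteDomainGraph D''.carrier δ).edgeSet ∧ (∃ x ∈ e, x ∈ P) ∧ ∃ y ∈ e, y ∈ Q})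
        {D''.pt 0, D''.pt 1} ≤ ENNReal.ofReal η ∧
      ∃ θ : ℝ, 0 < θ ∧ θ ≤ η ∧
        (∀ v : Site 2, (∀ z ∈ closure (D.carrier \ D''.carrier), θ ≤ dist (meshPoint δ v) z) →
          (v ∈ meshDomain D.carrier δ ↔ v ∈ meshDomain D''.carrier δ)) ∧
        (∀ v : Site 2, (∀ z ∈ closure (D.carrier \ D''.carrier), θ ≤ dist (meshPoint δ v) z) →
          (v ∈ P ↔ v ∈ SA) ∧ (v ∈ Q ↔ v ∈ SB)) ∧
        ∃ ea eb₁ eb₂ : Sym2 (Site 2),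
          {e | e ∈ (discreteDomainGraph D''.carrier δ).edgeSet ∧ (∃ x ∈ e, x ∈ P) ∧ ∃ y ∈ e, y ∈ Q} = {ea, eb₁} ∧
          {e | e ∈ (discreteDomainGraph D.carrier δ).edgeSet ∧ (∃ x ∈ e, x ∈ SA) ∧ ∃ y ∈ e, y ∈ SB} = {ea, eb₂} ∧
          (∀ x ∈ ea, ∀ z ∈ closure (D.carrier \ D''.carrier), θ + 4 * δ ≤ dist (meshPoint δ x) z) ∧
          dist (medialPoint δ ea) (D.pt 0) ≤ η ∧ dist (medialPoint δ eb₁) (D.pt 1) ≤ η ∧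
          dist (medialPoint δ eb₂) (D.pt 1) ≤ η := by
  set F : Set ℂ := closure (D.carrier \ D''.carrier) with hFd
  set a := D.pt 0 with haD
  set b := D.pt 1 with hbD
  -- the geometric constants
  obtain ⟨θa, hθa, ha3⟩ := exists_pos_forall_le_dist_of_not_mem isClosed_closure ha
  obtain ⟨θb, hθb, hb3⟩ : ∃ t : ℝ, 0 < t ∧ (b ∈ F ∨ ∀ z ∈ F, 3 * t ≤ dist b z) := by
    by_cases hbF : b ∈ F
    · exact ⟨1, one_pos, Or.inl hbF⟩
    · obtain ⟨t, ht, h⟩ := exists_pos_forall_le_dist_of_not_mem isClosed_closure hbF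
      exact ⟨t, ht, Or.inr h⟩
  have hab0 : 0 < dist a b := dist_pt_pos D
  set θ := min η (min θa (min θb (dist a b / 2))) with hθd
  have hθ0 : 0 < θ := lt_min hη (lt_min hθa (lt_min hθb (by positivity)))
  have hθη : θ ≤ η := min_le_left _ _
  have hθa' : θ ≤ θa := (min_le_right _ _).trans (min_le_left _ _)
  have hθb' : θ ≤ θb := (min_le_right _ _).trans ((min_le_right _ _).trans (min_le_left _ _))
  have hθab : θ ≤ dist a b / 2 := (min_le_right _ _).trans ((min_le_right _ _).trans (min_le_right _ _))
  have ha' : ∀ z ∈ F, 3 * θ ≤ dist a z := fun z hz => by linarith [ha3 z hz]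
  have hb' : b ∈ F ∨ ∀ z ∈ F, 3 * θ ≤ dist b z :=
    hb3.imp id fun h z hz => by linarith [h z hz]
  have hab : 2 * θ ≤ dist a b := by linarith
  obtain ⟨μ, hμ0, hμ⟩ := exists_arcs_separated D'' (half_pos hθ0)
  rw [h0, h1] at hμ
  -- the tolerance
  set ε := min η (min (θ / 4) (min (μ / 2) (dist a b / 4))) / 2 with hεd
  have hε0 : 0 < ε := by positivity
  have h2ε : 2 * ε = min η (min (θ / 4) (min (μ / 2) (dist a b / 4))) := by rw [hεd]; ring
  have hεη : 2 * ε ≤ η := h2ε ▸ min_le_left _ _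
  have hεθ : 2 * ε ≤ θ / 4 := h2ε ▸ (min_le_right _ _).trans (min_le_left _ _)
  have hεμ : 2 * ε ≤ μ / 2 := h2ε ▸ (min_le_right _ _).trans ((min_le_right _ _).trans (min_le_left _ _))
  have hεab : 2 * ε ≤ dist a b / 4 :=
    h2ε ▸ (min_le_right _ _).trans ((min_le_right _ _).trans (min_le_right _ _))
  have hlt : ENNReal.ofReal ε < ENNReal.ofReal (2 * ε) := (ENNReal.ofReal_lt_ofReal_iff (by linarith)).2 (by linarith)
  have hofη : ENNReal.ofReal (2 * ε) ≤ ENNReal.ofReal η := ENNReal.ofReal_le_ofReal hεη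
  -- all small meshes
  filter_upwards [eventually_labelling D hε0, eventually_labelling D'' hε0,
    eventually_mem_inner_of_far D.toJordanDomain D''.toJordanDomain hsub (show 0 < θ / 4 by positivity),
    eventually_meshDomain_inner_subset D.toJordanDomain D''.toJordanDomain hsub,
    Ioo_mem_nhdsGT (show (0 : ℝ) < min (θ / 16) (μ / 4) by positivity)] with δ hlabD hlabD'' hfar hsubM hδ
  have hδθ : 16 * δ ≤ θ := by linarith [hδ.2.trans_le (min_le_left _ _)]
  have hδμ : 4 * δ ≤ μ := by linarith [hδ.2.trans_le (min_le_right _ _)]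
  obtain ⟨SA, SB, hten, hH⟩ := hlabD
  obtain ⟨SA', SB', hten', hH'⟩ := hlabD''
  obtain ⟨c1, c2, c3, c4, c5, c6, c7, c8, c9, c10⟩ := hten
  obtain ⟨d1, d2, d3, d4, d5, d6, d7, d8, d9, d10⟩ := hten'
  -- the cut edges
  obtain ⟨ea, eb, hAB, -, hea, heb⟩ := exists_pair_of_hausdorffEDist_lt c9 (a := a) (b := b) (by linarith)
    (hH.trans_lt hlt)
  rw [h0, h1] at hH'
  obtain ⟨ea', eb', hAB', -, hea', heb'⟩ := exists_pair_of_hausdorffEDist_lt d9 (a := a) (b := b) (by linarith)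
    (hH'.trans_lt hlt)
  -- the discrete domains agree `θ/4`-far from `F`
  have hMM : ∀ v : Site 2, (∀ z ∈ F, θ / 4 ≤ dist (meshPoint δ v) z) →
      (v ∈ meshDomain D.carrier δ ↔ v ∈ meshDomain D''.carrier δ) := by
    intro v hv
    refine ⟨fun hM => ?_, fun hM'' => hsubM hM''⟩
    rcases eq_or_le_infDist hsub hv with heq | hle
    · have : meshDomain D''.carrier δ = meshDomain D.carrier δ := by rw [heq]
      rw [this]; exact hM
    · exact hfar v hM hle
  -- the patch
  set P : Set (Site 2) := {y | y ∈ (⟨D''.carrier, δ, ∅, ∅⟩ : DiscreteDobrushin).zdBoundary ∧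
      ((y ∈ SA ∧ ∀ z ∈ F, θ ≤ dist (meshPoint δ y) z) ∨ (y ∈ SA' ∧ ¬ ∀ z ∈ F, θ ≤ dist (meshPoint δ y) z))}
    with hPd
  set Q : Set (Site 2) := (⟨D''.carrier, δ, ∅, ∅⟩ : DiscreteDobrushin).zdBoundary \ P with hQd
  obtain ⟨⟨p1, p2, p3, p4, p5, p6, p7, p8, p9, p10⟩, hagree, hea_far, e2, hcut, hne2, he2⟩ :=
    locality_patch D D'' hsub hA0 hA1 (ε := 2 * ε) hδ.1 hμ ha' hb' hab (by linarith) hδθ (by linarith) hMM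
      c1 c2 c5 c6 (fun y hy => (c7 y hy).trans (by linarith)) (fun x hx => (c8 x hx).trans (by linarith))
      hAB (by linarith [hea.le]) (by linarith [heb.le]) c10
      d1 d2 d5 d6 (fun y hy => (d7 y hy).trans (by linarith)) (fun x hx => (d8 x hx).trans (by linarith))
      hAB' (by linarith [hea'.le]) (by linarith [heb'.le]) d10 hPd hQd
  refine ⟨SA, SB, P, Q, ⟨c1, c2, c3, c4, c5, c6, fun y hy => (c7 y hy).trans (by linarith),
    fun x hx => (c8 x hx).trans (by linarith), c9, c10⟩, hH.trans (hlt.le.trans hofη),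
    ⟨p1, p2, p3, p4, p5, p6, fun y hy => (p7 y hy).trans hεη, fun x hx => (p8 x hx).trans hεη, p9, p10⟩, ?_,
    θ, hθ0, hθη, fun v hv => hMM v (fun z hz => by linarith [hv z hz]), hagree, ea, e2, eb, hcut, hAB,
    fun x hx z hz => by linarith [hea_far x hx z hz], by linarith [hea.le], he2.trans hεη, by linarith [heb.le]⟩
  rw [hcut, h0, h1]
  exact (hausdorffEDist_pair_le (by linarith [hea.le]) he2).trans hofη

/-! ### Registered sub-goal (one-line signature, verbatim) -/

/-- **Registered sub-goal `stub_discreteLocality_labels` of `stub_discreteLocality`**: compatible labellings at every small mesh (`locality_labels`), fully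
quantified. -/
theorem stub_discreteLocality_labels : ∀ (D D'' : DobrushinDomain), (D''.carrier ⊆ D.carrier) → (D''.pt 0 = D.pt 0) → (D''.pt 1 = D.pt 1) → (∀ z ∈ D.arc 0, z ∉ closure (D.carrier \ D''.carrier) → z ∈ D''.arc 0) → (∀ z ∈ D.arc 1, z ∉ closure (D.carrier \ D''.carrier) → z ∈ D''.arc 1) → (D.pt 0 ∉ closure (D.carrier \ D''.carrier)) → ∀ (η : ℝ), (0 < η) → ∀ᶠ δ in 𝓝[>] (0 : ℝ), ∃ SA SB P Q : Set (Site 2), (SA ∪ SB = (⟨D.carrier, δ, ∅, ∅⟩ : DiscreteDobrushin).zdBoundary ∧ Disjoint SA SB ∧ SA.Nonempty ∧ SB.Nonempty ∧ (∀ y ∈ SA, ¬ closedBall (meshPoint δ y) (infDist (meshPoint δ y) (frontier D.carrier)) ⊆ ⋃ x ∈ SB, closedBall (meshPoint δ x) (infDist (meshPoint δ x) (frontier D.carrier))) ∧ (∀ x ∈ SB, ¬ closedBall (meshPoint δ x) (infDist (meshPoint δ x) (frontier D.carrier)) ⊆ ⋃ y ∈ SA, closedBall (meshPoint δ y) (infDist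 (meshPoint δ y) (frontier D.carrier))) ∧ (∀ y ∈ SA, infDist (meshPoint δ y) (D.arc 0) ≤ η) ∧ (∀ x ∈ SB, infDist (meshPoint δ x) (D.arc 1) ≤ η) ∧ {e | e ∈ (discreteDomainGraph D.carrier δ).edgeSet ∧ (∃ x ∈ e, x ∈ SA) ∧ ∃ y ∈ e, y ∈ SB}.ncard = 2 ∧ ∀ e ∈ (discreteDomainGraph D.carrier δ).edgeSet, (∃ x ∈ e, x ∈ SA) → (∃ y ∈ e, y ∈ SB) → ∃! f, (⟨D.carrier, δ, ∅, ∅⟩ : DiscreteDobrushin).IsInnerFace f ∧ ∀ x ∈ e, IsCorner x f) ∧ hausdorffEDist (medialPoint δ '' {e | e ∈ (discreteDomainGraph D.carrier δ).edgeSet ∧ (∃ x ∈ e, x ∈ SA) ∧ ∃ y ∈ e, y ∈ SB}) {D.pt 0, D.pt 1} ≤ ENNReal.ofReal η ∧ (P ∪ Q = (⟨D''.carrier, δ, ∅, ∅⟩ : DiscreteDobrushin).zdBoundary ∧ Disjoint P Q ∧ P.Nonempty ∧ Q.Nonempty ∧ (∀ y ∈ P, ¬ closedBall (meshPoint δ y)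 (infDist (meshPoint δ y) (frontier D''.carrier)) ⊆ ⋃ x ∈ Q, closedBall (meshPoint δ x) (infDist (meshPoint δ x) (frontier D''.carrier))) ∧ (∀ x ∈ Q, ¬ closedBall (meshPoint δ x) (infDist (meshPoint δ x) (frontier D''.carrier)) ⊆ ⋃ y ∈ P, closedBall (meshPoint δ y) (infDist (meshPoint δ y) (frontier D''.carrier))) ∧ (∀ y ∈ P, infDist (meshPoint δ y) (D''.arc 0) ≤ η) ∧ (∀ x ∈ Q, infDist (meshPoint δ x) (D''.arc 1) ≤ η) ∧ {e | e ∈ (discreteDomainGraph D''.carrier δ).edgeSet ∧ (∃ x ∈ e, x ∈ P) ∧ ∃ y ∈ e, y ∈ Q}.ncard = 2 ∧ ∀ e ∈ (discreteDomainGraph D''.carrier δ).edgeSet, (∃ x ∈ e, x ∈ P) → (∃ y ∈ e, y ∈ Q) → ∃! f, (⟨D''.carrier, δ, ∅, ∅⟩ : DiscreteDobrushin).IsInnerFace f ∧ ∀ x ∈ e, IsCorner x f) ∧ hausdorffEDist (medialPoint δ '' {e | e ∈ (discreteDomainGraph D''.carrier δ).edgeSet ∧ (∃ x ∈ e, x ∈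 P) ∧ ∃ y ∈ e, y ∈ Q}) {D''.pt 0, D''.pt 1} ≤ ENNReal.ofReal η ∧ ∃ θ : ℝ, 0 < θ ∧ θ ≤ η ∧ (∀ v : Site 2, (∀ z ∈ closure (D.carrier \ D''.carrier), θ ≤ dist (meshPoint δ v) z) → (v ∈ meshDomain D.carrier δ ↔ v ∈ meshDomain D''.carrier δ)) ∧ (∀ v : Site 2, (∀ z ∈ closure (D.carrier \ D''.carrier), θ ≤ dist (meshPoint δ v) z) → (v ∈ P ↔ v ∈ SA) ∧ (v ∈ Q ↔ v ∈ SB)) ∧ ∃ ea eb₁ eb₂ : Sym2 (Site 2), {e | e ∈ (discreteDomainGraph D''.carrier δ).edgeSet ∧ (∃ x ∈ e, x ∈ P) ∧ ∃ y ∈ e, y ∈ Q} = {ea, eb₁} ∧ {e | e ∈ (discreteDomainGraph D.carrier δ).edgeSet ∧ (∃ x ∈ e, x ∈ SA) ∧ ∃ y ∈ e, y ∈ SB} = {ea, eb₂} ∧ (∀ x ∈ ea, ∀ z ∈ closure (D.carrier \ D''.carrier), θ + 4 * δ ≤ dist (meshPoint δ x) z) ∧ dist (medialPoint δ ea) (D.pt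 0) ≤ η ∧ dist (medialPoint δ eb₁) (D.pt 1) ≤ η ∧ dist (medialPoint δ eb₂) (D.pt 1) ≤ η :=
  fun D D'' hsub h0 h1 hA0 hA1 ha _ hη => locality_labels D D'' hsub h0 h1 hA0 hA1 ha hη

end Summit.CriticalPhenomena.CardyFormulaZ2.Cruxes.LagHandOff.HittingTournament

end
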